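import Summits.Schanuel.Schanuel.Theses.RoyCriterion
import Literature.Barriers.Schanuel.AlgebraicIndependenceOfLogarithms
import Literature.Barriers.Schanuel.LargeTranscendenceDegreeSmallTrdegProofs
import Literature.Barriers.Schanuel.SchanuelPropertyNotFirstOrder
import Literature.NumberTheory.Transcendental.PeriodsWave0NesterenkoProofs
import Literature.Barriers.Schanuel.AxiomsDoNotForceSchanuel
import Literature.NumberTheory.Transcendental.KirbyWeakSchanuelAx

/-!
# Disproof of `SchanuelTwo` (crux stmt-Schanuel-0069, routes RoyCriterion / EclCore) — findings

`SchanuelTwo := ∀ x : Fin 2 → ℂ, LinearIndependent ℚ x → 2 ≤ trdeg_ℚ ℚ(x, e^x)` is the `n = 2`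
case of Schanuel's conjecture (Lang 1966). It is a GENUINE OPEN PROBLEM: a disproof is an explicit
`ℚ`-linearly independent pair `x` with `trdeg_ℚ ℚ(x₁, x₂, e^{x₁}, e^{x₂}) = 1` EXACTLY (see
`counterexample_profile`), e.g. an algebraic relation between `e` and `π`. No such pair is known
or conjectured, and none can be certified by a finite computation (an algebraic relation between
two real constants cannot be verified numerically). This work file records, in Lean (all
sorry-free; the gate accepts from a refuter only `¬ <Theses decl>` under `Theorems/`, so this
content travels as item EVIDENCE of stmt-Schanuel-0069 and is importable from the published path
`Summits/Schanuel/Schanuel/Cruxes/schanuel_two/Disproof.lean` once the harness publishes it):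

* §1 LOAD-BEARING ANALYSIS — the single hypothesis `LinearIndependent ℚ x` is necessary:
  `schanuelTwo_false_without_linIndep` (witness `x = 0`), and it cannot be weakened to "non-zero,
  pairwise distinct": `schanuelTwo_false_with_nonzero_injective` (witness `x = (1, 2)`:
  `ℚ(1, 2, e, e²) = ℚ(e)` has transcendence degree `≤ 1`). Any proof must use the `ℚ`-structure.
* §2 THE KNOWN LOCUS — `SchanuelTwo x` is a THEOREM of the tree for: `x ∈ ℚ̄²`
  (Lindemann–Weierstrass, `schanuelTwo_of_isAlgebraic`), `x` algebraically independent
  (trivial, `schanuelTwo_of_algebraicIndependent`), `x = (iπ, π)` and every `x` with a coordinate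
  equal to `π` (Nesterenko 1996, `schanuelTwo_at_piI_pi`, `schanuelTwo_of_apply_eq_pi`; whole
  `ℚ`-planes through `π` or `π√3` in §9). So the OPEN content is exactly: `x` `ℚ`-linearly
  independent, algebraically DEPENDENT, with a transcendental coordinate, off those planes.
* §3 TIGHTNESS — the bound `2` is attained: `schanuelTwo_tight` (`x = (1, √2)`, trdeg `= 2`).
* §4 REFUTED NATURAL STRENGTHENINGS — `not_schanuelTwoThree` (`3 ≤ trdeg` fails at `(1, √2)`),
  `not_schanuelTwoExpPart` (`1 ≤ trdeg ℚ(e^{x})` fails at `(iπ, log 2)`),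
  `not_schanuelTwoBasePart` (`1 ≤ trdeg ℚ(x)` fails at `(1, √2)`),
  `not_schanuelTwoSplit` (`x` alg. independent ∨ `e^x` alg. independent FAILS at `(iπ, π)`, where
  `SchanuelTwo` itself HOLDS): the two transcendentals promised by Schanuel cannot be localised on
  one sort, so no sort-by-sort argument can prove the crux; `not_schanuelTwoBaseTwo` (the same
  statement for `2^z` FAILS at `(1, πi/log 2)`: the crux is specific to `exp`, `e` transcendental).
* §5 COUNTEREXAMPLE PROFILE — `one_le_trdeg_of_linearIndependent` (Hermite–Lindemann gives
  `trdeg ≥ 1` unconditionally), `schanuelTwo_iff_trdeg_ne_one` (the crux is exactly "trdeg is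
  never `1`"), `counterexample_profile` (a counterexample has a transcendental coordinate, is
  algebraically dependent on BOTH sorts, and has trdeg exactly `1`).
* §6 REDUCTIONS — `schanuelTwo_iff_schanuelRank_two`, `schanuelTwo_iff_royCriterion_two`
  (Roy's criterion in rank 2, via the tree's `Roy2001_iff_holds`), and the four named OPEN
  instances as consequences: `schanuelTwo_imp_expOnePi` (`e, π`), `schanuelTwo_imp_e_exp_e`
  (`e, e^e`), `schanuelTwo_imp_log_two_two_pow_sqrt_two` (`log 2, 2^{√2}`),
  `schanuelTwo_imp_piI_log_two` (`π, log 2`), and `schanuelTwo_imp_algIndepLogarithms_two` (any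
  two `ℚ`-independent logarithms of algebraic numbers — "not even one such pair is known",
  Roy 1992), whence `schanuelTwo_imp_transcendental_exp_pi_sq` (`e^{π²} ∉ ℚ̄`, open). Each is a
  sufficient target for a refutation: an algebraic relation there (or `e^{π²} ∈ ℚ̄`) kills the crux.
* §7 BARRIER REDUCTION — `not_schanuelTwoIn_of_kernel_relation`,
  `exists_isSoftZilberField_not_schanuelTwoIn`: already the `n = 2` slice fails in Bays–Kirby's
  soft Zilber fields `𝔹_P` (all of Zilber's axioms but Schanuel), so the crux is not "soft".
* §8 WHERE TO LOOK — `schanuelTwo_iff_ecl`: Kirby's reduction sliced at rank 2 (from the tree's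
  PROVED Ax–Kirby weak Schanuel theorem): the crux is equivalent to its restriction to pairs of
  exponentially algebraic numbers, so a counterexample may be sought in the countable `ecl(∅)²`.
* §9 PLANE INVARIANCE — `trdeg_SF_eq_of_span_eq`: `trdeg ℚ(x, e^x)` depends only on the
  `ℚ`-plane `span_ℚ(x)` (`GL₂(ℚ)`-invariance; Zilber's predimension of the plane);
  `schanuelTwo_of_pi_mem_span`, `schanuelTwo_of_pi_mul_sqrt_three_mem_span`: every plane through
  `π` or `π√3` satisfies the crux (Nesterenko at `τ = i, ρ`), e.g. `schanuelTwo_at_piI_pi_mul_sqrt_three`.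
* Numerical evidence (asynchronous; the compute queue was saturated during cycle 1): kit jobs
  `j013163` (PSLQ exclusion of integer polynomial relations of total degree `≤ 6`, height caps
  `10^6 … 10^12`, among `(e, π)`, `(e, e^e)`, `(log 2, 2^{√2})`, `(π, log 2)`, with a positive
  control `(π, π² + π)` and a Lindemann–Weierstrass control `(e, e^{√2})`) and `j005649` (same,
  degree `≤ 8`); script `pslqjob/main.py` in the disprover's folder; each job attaches
  `outputs/summary.txt` (+ sha256 manifest) to item stmt-Schanuel-0069 on completion. Evidence
  only (standard PSLQ norm-bound exclusion at the stated precision), consistent with the crux;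
  prior computations of this kind: Bailey 1988 (Math. Comp. 50, 275–281), Bailey–Ferguson 1989
  (Math. Comp. 53, 649–656) — acquisition requests acq-05683 / acq-04335.

WHY IT RESISTS (for the provers): every method in the tree that outputs `trdeg ≥ 2` needs at
least three exponentials with shared structure — Lindemann–Weierstrass needs algebraic exponents;
Gel'fond / Brownawell–Waldschmidt (`Literature.NumberTheory.Transcendental.BrownawellWaldschmidt`)
need a `d × ℓ` grid with `dℓ ≥ d + ℓ`; Nesterenko needs the modular triple `(q, P, Q, R)` — while
a bare pair `(x₁, x₂)` with one transcendental coordinate carries no such structure (barriers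
`Literature.Barriers.Schanuel.LargeTranscendenceDegree`, `…AlgebraicIndependenceOfLogarithms`,
`…NesterenkoModularScope`). Conversely a refutation needs an exact algebraic relation between
specific classical constants, which no finite computation certifies; the essential
counterexamples live in the countable field `ecl(∅)` (Kirby 2010, Prop. 7.2; tree:
`Literature.NumberTheory.Transcendental.schanuelConjecture_iff_ecl_empty_holds`).
-/

-- Single-conjunct summit: `Summit.Schanuel.Schanuel.…` is the mandated namespace (D-0017); the
-- Summits library sets this option in the lakefile, repeated here for standalone `lean check`.
set_option linter.dupNamespace false

noncomputable section

open Complex IntermediateField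
open Literature.Barriers.Schanuel (trdeg_mono trdeg_adjoin_pair_le_two trdeg_adjoin_singleton_le_one
  trdeg_adjoin_union_eq_of_isAlgebraic algebraicIndependent_of_le_trdeg_adjoin)
open Summit.Schanuel.Schanuel.Theses.RoyCriterion (SchanuelTwo)

namespace Summit.Schanuel.Schanuel.Cruxes.SchanuelTwo.Disproof

/-! ### §0 Bookkeeping helpers -/

/-- The Schanuel field `ℚ(x, e^x)` of a pair, as it appears in the crux. [folklore] -/
abbrev SF (x : Fin 2 → ℂ) : IntermediateField ℚ ℂ :=
  adjoin ℚ (Set.range x ∪ Set.range (Complex.exp ∘ x))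

/-- Unfolding of the crux against `SF`. [folklore] -/
theorem schanuelTwo_iff :
    SchanuelTwo ↔ ∀ x : Fin 2 → ℂ, LinearIndependent ℚ x → (2 : Cardinal) ≤ Algebra.trdeg ℚ (SF x) :=
  Iff.rfl

/-- A field generated by algebraic elements has transcendence degree `0`. [folklore] -/
theorem trdeg_adjoin_eq_zero_of_forall_isAlgebraic {S : Set ℂ} (h : ∀ z ∈ S, IsAlgebraic ℚ z) :
    Algebra.trdeg ℚ (adjoin ℚ S) = 0 := by
  haveI : Algebra.IsAlgebraic ℚ (adjoin ℚ S) :=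
    IntermediateField.isAlgebraic_adjoin fun z hz => (h z hz).isIntegral
  exact trdeg_eq_zero

/-- `SF x ≤ L` from membership of the four generators. [folklore] -/
theorem SF_le {x : Fin 2 → ℂ} {L : IntermediateField ℚ ℂ} (h0 : x 0 ∈ L) (h1 : x 1 ∈ L)
    (e0 : cexp (x 0) ∈ L) (e1 : cexp (x 1) ∈ L) : SF x ≤ L := by
  rw [adjoin_le_iff]
  rintro z (⟨i, rfl⟩ | ⟨i, rfl⟩)
  · fin_cases i
    · exact h0
    · exact h1
  · fin_cases i
    · exact e0
    · exact e1

/-- An algebraically independent pair inside `L` forces `2 ≤ trdeg L`. [folklore] -/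
theorem two_le_trdeg_of_algebraicIndependent {L : IntermediateField ℚ ℂ} {v : Fin 2 → ℂ}
    (hv : AlgebraicIndependent ℚ v) (hmem : ∀ i, v i ∈ L) :
    (2 : Cardinal) ≤ Algebra.trdeg ℚ L := by
  let y : Fin 2 → L := fun i => ⟨v i, hmem i⟩
  have hy : AlgebraicIndependent ℚ y := AlgebraicIndependent.of_comp L.val hv
  simpa using hy.cardinalMk_le_trdeg

/-! ### §1 Load-bearing analysis: the hypothesis `LinearIndependent ℚ x` -/

/-- `SchanuelTwo` with its only hypothesis, `LinearIndependent ℚ x`, dropped. [folklore] -/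
def SchanuelTwoWithoutLinIndep : Prop :=
  ∀ x : Fin 2 → ℂ, (2 : Cardinal) ≤ Algebra.trdeg ℚ (SF x)

/-- **Any proof must use linear independence**: without it the statement fails at `x = 0`
(`ℚ(0, 0, 1, 1) = ℚ`, transcendence degree `0`). [folklore] -/
theorem schanuelTwo_false_without_linIndep : ¬ SchanuelTwoWithoutLinIndep := by
  intro h
  have h0 := h 0
  have halg : ∀ z ∈ Set.range (0 : Fin 2 → ℂ) ∪ Set.range (Complex.exp ∘ (0 : Fin 2 → ℂ)),
      IsAlgebraic ℚ z := by
    rintro z (⟨i, rfl⟩ | ⟨i, rfl⟩)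
    · simpa using isAlgebraic_zero
    · simpa using isAlgebraic_one
  have : Algebra.trdeg ℚ (SF (0 : Fin 2 → ℂ)) = 0 := trdeg_adjoin_eq_zero_of_forall_isAlgebraic halg
  rw [this] at h0
  exact (not_le.mpr zero_lt_two) h0

/-- `SchanuelTwo` with `LinearIndependent ℚ x` WEAKENED to "the `xᵢ` are non-zero and pairwise
distinct" (the naive non-degeneracy condition). [folklore] -/
def SchanuelTwoNonzeroInjective : Prop :=
  ∀ x : Fin 2 → ℂ, Function.Injective x → (∀ i, x i ≠ 0) →
    (2 : Cardinal) ≤ Algebra.trdeg ℚ (SF x)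

/-- **Linear independence cannot be weakened to non-degeneracy**: at `x = (1, 2)` (non-zero,
distinct, but `ℚ`-linearly dependent) `ℚ(1, 2, e, e²) = ℚ(e)` has transcendence degree `≤ 1`.
So the `ℚ`-structure of the hypothesis is what any proof must exploit. [folklore] -/
theorem schanuelTwo_false_with_nonzero_injective : ¬ SchanuelTwoNonzeroInjective := by
  intro h
  set x : Fin 2 → ℂ := ![1, 2] with hxdef
  have hx : Function.Injective x := by
    intro i j hij
    fin_cases i <;> fin_cases j
    · rfl
    · exact absurd hij (by simp [hxdef])
    · exact absurd hij (by simp [hxdef])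
    · rfl
  have hne : ∀ i, x i ≠ 0 := by
    intro i; fin_cases i <;> simp [hxdef]
  have h2 := h x hx hne
  have hle : SF x ≤ adjoin ℚ ({cexp 1} : Set ℂ) := by
    have he : cexp 1 ∈ adjoin ℚ ({cexp 1} : Set ℂ) := subset_adjoin ℚ _ (Set.mem_singleton _)
    refine SF_le ?_ ?_ ?_ ?_
    · simp only [hxdef, Matrix.cons_val_zero]; exact one_mem _
    · simp only [hxdef, Matrix.cons_val_one, Matrix.cons_val_fin_one]; exact ofNat_mem _ 2
    · simp only [hxdef, Matrix.cons_val_zero]; exact he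
    · simp only [hxdef, Matrix.cons_val_one, Matrix.cons_val_fin_one]
      rw [show (2 : ℂ) = 1 + 1 by norm_num, Complex.exp_add]
      exact mul_mem he he
  have := (h2.trans (trdeg_mono hle)).trans
    (Literature.Barriers.Schanuel.trdeg_adjoin_singleton_le_one (K := ℚ) (cexp 1))
  exact Nat.not_ofNat_le_one this

/-! ### §2 The known locus (positive instances proved in the tree) -/

/-- **Lindemann–Weierstrass case** (PROVED in tree, `LindemannWeierstrass.AlgIndep_holds`): for
`x ∈ ℚ̄²` `ℚ`-linearly independent, `e^{x₁}, e^{x₂}` are algebraically independent, so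
`SchanuelTwo x` holds (with equality, §3). [cite: BakerTNT1975, Ch. 1 Theorem 1.4] -/
theorem schanuelTwo_of_isAlgebraic (x : Fin 2 → ℂ) (halg : ∀ i, IsAlgebraic ℚ (x i))
    (hx : LinearIndependent ℚ x) : (2 : Cardinal) ≤ Algebra.trdeg ℚ (SF x) := by
  have hind : AlgebraicIndependent ℚ (cexp ∘ x) :=
    Literature.NumberTheory.Transcendental.LindemannWeierstrass.AlgIndep_holds 2 x halg hx
  exact two_le_trdeg_of_algebraicIndependent hind
    fun i => subset_adjoin ℚ _ (Or.inr ⟨i, rfl⟩)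

/-- **Trivial case**: if `x` itself is algebraically independent over `ℚ` the conclusion holds
with no transcendence input. Hence the OPEN content of the crux is exactly the locus
"`x` `ℚ`-linearly independent, algebraically dependent, not in `ℚ̄²`". [folklore] -/
theorem schanuelTwo_of_algebraicIndependent (x : Fin 2 → ℂ) (hx : AlgebraicIndependent ℚ x) :
    (2 : Cardinal) ≤ Algebra.trdeg ℚ (SF x) :=
  two_le_trdeg_of_algebraicIndependent hx fun i => subset_adjoin ℚ _ (Or.inl ⟨i, rfl⟩)

/-- `π` and `e^π` are algebraically independent over `ℚ` (as complex numbers): the first two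
coordinates of Nesterenko's triple `(π, e^π, Γ(1/4))`, PROVED in the tree
(`Literature.NumberTheory.Transcendental.nesterenko_holds`). [cite: NesterenkoPhilippon2001, Ch. 3 Corollary 1.2] -/
theorem algebraicIndependent_pi_exp_pi :
    AlgebraicIndependent ℚ ![(Real.pi : ℂ), ((Real.exp Real.pi : ℝ) : ℂ)] := by
  have hN := Literature.NumberTheory.Transcendental.nesterenko_holds
  have h2 : AlgebraicIndependent ℚ ![Real.pi, Real.exp Real.pi] := by
    have h := hN.comp ![(0 : Fin 3), 1] (by decide)
    convert h using 1
    funext i; fin_cases i <;> rfl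
  have e : (![(Real.pi : ℂ), ((Real.exp Real.pi : ℝ) : ℂ)] : Fin 2 → ℂ) =
      (Complex.ofRealAm.restrictScalars ℚ) ∘ ![Real.pi, Real.exp Real.pi] := by
    funext i; fin_cases i <;> simp
  rw [e]
  exact h2.map' Complex.ofReal_injective

/-- `(iπ, π)` is `ℚ`-linearly independent (imaginary and real parts). [folklore] -/
theorem linearIndependent_piI_pi : LinearIndependent ℚ ![(Real.pi : ℂ) * I, (Real.pi : ℂ)] := by
  rw [LinearIndependent.pair_iff]
  intro s t hst
  have hre := congrArg Complex.re hst
  have him := congrArg Complex.im hst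
  simp only [Complex.add_re, Complex.add_im, Complex.smul_re, Complex.smul_im, Complex.mul_re,
    Complex.mul_im, Complex.ofReal_re, Complex.ofReal_im, Complex.I_re, Complex.I_im,
    Complex.zero_re, Complex.zero_im, mul_zero, mul_one, sub_zero, add_zero,
    zero_add, smul_zero] at hre him
  constructor
  · rw [Rat.smul_def, mul_eq_zero] at him
    rcases him with h | h
    · exact_mod_cast h
    · exact absurd h Real.pi_ne_zero
  · rw [Rat.smul_def, mul_eq_zero] at hre
    rcases hre with h | h
    · exact_mod_cast h
    · exact absurd h Real.pi_ne_zero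

/-- **Nesterenko case `x = (iπ, π)`** (PROVED in tree): `ℚ(iπ, π, e^{iπ} = −1, e^π) ⊇ {π, e^π}`,
algebraically independent, so `SchanuelTwo` holds at this algebraically DEPENDENT pair with a
transcendental coordinate — the only kind of point of the open locus where the crux is known.
[cite: NesterenkoPhilippon2001, Ch. 3 Corollary 1.2] -/
theorem schanuelTwo_at_piI_pi :
    (2 : Cardinal) ≤ Algebra.trdeg ℚ (SF ![(Real.pi : ℂ) * I, (Real.pi : ℂ)]) := by
  refine two_le_trdeg_of_algebraicIndependent algebraicIndependent_pi_exp_pi ?_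
  intro i
  fin_cases i
  · simp only [Fin.zero_eta, Fin.isValue, Matrix.cons_val_zero]
    exact subset_adjoin ℚ _ (Or.inl ⟨1, by simp⟩)
  · simp only [Fin.mk_one, Fin.isValue, Matrix.cons_val_one, Matrix.cons_val_fin_one]
    refine subset_adjoin ℚ _ (Or.inr ⟨1, ?_⟩)
    simp [Complex.ofReal_exp]


/-- **The whole line `xᵢ = π`** (PROVED in tree): if one coordinate of `x` IS `π` then
`SchanuelTwo x` holds with no further hypothesis (`{π, e^π} ⊆ ℚ(x, e^x)`, Nesterenko). E.g.
`x = (π, πα)` for every irrational `α`, `x = (π, log 2)`, `x = (π, e)`.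
[cite: NesterenkoPhilippon2001, Ch. 3 Corollary 1.2] -/
theorem schanuelTwo_of_apply_eq_pi (x : Fin 2 → ℂ) (i : Fin 2) (hi : x i = Real.pi) :
    (2 : Cardinal) ≤ Algebra.trdeg ℚ (SF x) := by
  refine two_le_trdeg_of_algebraicIndependent algebraicIndependent_pi_exp_pi ?_
  intro j
  fin_cases j
  · simp only [Fin.zero_eta, Fin.isValue, Matrix.cons_val_zero]
    rw [← hi]
    exact subset_adjoin ℚ _ (Or.inl ⟨i, rfl⟩)
  · simp only [Fin.mk_one, Fin.isValue, Matrix.cons_val_one, Matrix.cons_val_fin_one]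
    rw [Complex.ofReal_exp, ← hi]
    exact subset_adjoin ℚ _ (Or.inr ⟨i, rfl⟩)

/-! ### §3 Tightness: the bound `2` is attained -/

/-- `(1, √2)` is `ℚ`-linearly independent (irrationality of `√2`). [folklore] -/
theorem linearIndependent_one_sqrt_two :
    LinearIndependent ℚ ![(1 : ℂ), ((Real.sqrt 2 : ℝ) : ℂ)] := by
  rw [LinearIndependent.pair_iff]
  intro s t hst
  have hre := congrArg Complex.re hst
  simp only [Complex.add_re, Complex.smul_re, Complex.one_re, Complex.ofReal_re,
    Complex.zero_re] at hre
  have hre' : (s : ℝ) + (t : ℝ) * Real.sqrt 2 = 0 := by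
    simpa [Rat.smul_def] using hre
  by_cases ht : t = 0
  · subst ht
    have hs : (s : ℝ) = 0 := by simpa using hre'
    exact ⟨by exact_mod_cast hs, rfl⟩
  · exfalso
    apply irrational_sqrt_two
    refine ⟨-s / t, ?_⟩
    have ht' : (t : ℝ) ≠ 0 := by exact_mod_cast ht
    push_cast
    field_simp
    linarith

/-- Both coordinates of `(1, √2)` are algebraic. [folklore] -/
theorem isAlgebraic_one_sqrt_two : ∀ i, IsAlgebraic ℚ ((![(1 : ℂ), ((Real.sqrt 2 : ℝ) : ℂ)]) i) := by
  intro i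
  fin_cases i
  · simpa using isAlgebraic_one
  · simp only [Fin.mk_one, Fin.isValue, Matrix.cons_val_one, Matrix.cons_val_fin_one]
    refine ⟨Polynomial.X ^ 2 - Polynomial.C 2, ?_, ?_⟩
    · exact Polynomial.X_pow_sub_C_ne_zero (by norm_num) 2
    · simp only [map_sub, map_pow, Polynomial.aeval_X, Polynomial.aeval_C]
      rw [← Complex.ofReal_pow, Real.sq_sqrt (by norm_num : (0 : ℝ) ≤ 2)]
      simp

/-- Upper bound: `trdeg ℚ(1, √2, e, e^{√2}) ≤ 2` (the coordinates are algebraic, two generators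
remain). [folklore] -/
theorem trdeg_SF_one_sqrt_two_le :
    Algebra.trdeg ℚ (SF ![(1 : ℂ), ((Real.sqrt 2 : ℝ) : ℂ)]) ≤ 2 := by
  set x : Fin 2 → ℂ := ![(1 : ℂ), ((Real.sqrt 2 : ℝ) : ℂ)] with hxdef
  have hT : ∀ z ∈ Set.range x, IsAlgebraic ℚ z := by
    rintro _ ⟨i, rfl⟩; exact isAlgebraic_one_sqrt_two i
  have heq : Algebra.trdeg ℚ (SF x) =
      Algebra.trdeg ℚ (adjoin ℚ (Set.range (Complex.exp ∘ x))) := by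
    have hset : Set.range x ∪ Set.range (Complex.exp ∘ x) =
        Set.range (Complex.exp ∘ x) ∪ Set.range x := Set.union_comm _ _
    show Algebra.trdeg ℚ (adjoin ℚ (Set.range x ∪ Set.range (Complex.exp ∘ x))) = _
    rw [hset]
    exact Literature.Barriers.Schanuel.trdeg_adjoin_union_eq_of_isAlgebraic _ _ hT
  rw [heq]
  have hle : adjoin ℚ (Set.range (Complex.exp ∘ x)) ≤
      adjoin ℚ ({cexp (x 0), cexp (x 1)} : Set ℂ) := by
    apply adjoin.mono
    rintro _ ⟨i, rfl⟩
    fin_cases i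
    · exact Or.inl rfl
    · exact Or.inr rfl
  exact (trdeg_mono hle).trans (trdeg_adjoin_pair_le_two (K := ℚ) (cexp (x 0)) (cexp (x 1)))

/-- **Tightness of the crux**: the Schanuel bound `2` is attained at the `ℚ`-linearly independent
pair `(1, √2)`: `trdeg ℚ(1, √2, e, e^{√2}) = 2` (Lindemann–Weierstrass for `≥`, algebraicity of the
coordinates for `≤`). No strengthening of the constant is possible. [cite: BakerTNT1975, Ch. 1 Theorem 1.4] -/
theorem schanuelTwo_tight :
    ∃ x : Fin 2 → ℂ, LinearIndependent ℚ x ∧ Algebra.trdeg ℚ (SF x) = 2 :=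
  ⟨_, linearIndependent_one_sqrt_two, le_antisymm trdeg_SF_one_sqrt_two_le
    (schanuelTwo_of_isAlgebraic _ isAlgebraic_one_sqrt_two linearIndependent_one_sqrt_two)⟩

/-! ### §4 Refuted natural strengthenings -/

/-- Strengthening 1: conclusion `3 ≤ trdeg`. [folklore] -/
def SchanuelTwoThree : Prop :=
  ∀ x : Fin 2 → ℂ, LinearIndependent ℚ x → (3 : Cardinal) ≤ Algebra.trdeg ℚ (SF x)

/-- `3 ≤ trdeg` FAILS at `(1, √2)` (trdeg `= 2`). [folklore] -/
theorem not_schanuelTwoThree : ¬ SchanuelTwoThree := by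
  intro h
  have h32 := (h _ linearIndependent_one_sqrt_two).trans trdeg_SF_one_sqrt_two_le
  have : ¬ ((3 : ℕ) : Cardinal.{0}) ≤ ((2 : ℕ) : Cardinal.{0}) := by
    rw [Nat.cast_le]; norm_num
  exact this (by exact_mod_cast h32)

/-- Strengthening 2: the exponential sort alone carries a transcendental. [folklore] -/
def SchanuelTwoExpPart : Prop :=
  ∀ x : Fin 2 → ℂ, LinearIndependent ℚ x →
    (1 : Cardinal) ≤ Algebra.trdeg ℚ (adjoin ℚ (Set.range (Complex.exp ∘ x)))

/-- `1 ≤ trdeg ℚ(e^{x₁}, e^{x₂})` FAILS at `x = (iπ, log 2)` (`e^x = (−1, 2)`): two `ℚ`-linearly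
independent logarithms of rational numbers. At this very point `SchanuelTwo` predicts
`trdeg ℚ(π, log 2) = 2`, which is OPEN (not even one pair of algebraically independent logarithms
of algebraic numbers is known, Roy 1992). [cite: Roy1992, Introduction p. 22] -/
theorem not_schanuelTwoExpPart : ¬ SchanuelTwoExpPart := by
  intro h
  have h1 := h _ Literature.Barriers.Schanuel.linearIndependent_piI_log_two
  have halg : ∀ z ∈ Set.range (Complex.exp ∘ ![(Real.pi : ℂ) * I, (Real.log 2 : ℂ)]),
      IsAlgebraic ℚ z := by
    rintro _ ⟨i, rfl⟩
    fin_cases i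
    · simp only [Fin.zero_eta, Fin.isValue, Function.comp_apply, Matrix.cons_val_zero,
        Complex.exp_pi_mul_I]
      simpa using isAlgebraic_algebraMap (R := ℚ) (A := ℂ) (-1)
    · simp only [Fin.mk_one, Fin.isValue, Function.comp_apply, Matrix.cons_val_one,
        Matrix.cons_val_fin_one]
      rw [← Complex.ofReal_exp, Real.exp_log two_pos]
      simpa using isAlgebraic_algebraMap (R := ℚ) (A := ℂ) 2
  rw [trdeg_adjoin_eq_zero_of_forall_isAlgebraic halg] at h1
  exact absurd h1 (by simp)

/-- Strengthening 3: the base sort alone carries a transcendental. [folklore] -/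
def SchanuelTwoBasePart : Prop :=
  ∀ x : Fin 2 → ℂ, LinearIndependent ℚ x →
    (1 : Cardinal) ≤ Algebra.trdeg ℚ (adjoin ℚ (Set.range x))

/-- `1 ≤ trdeg ℚ(x₁, x₂)` FAILS at `(1, √2)`. Together with `not_schanuelTwoExpPart`: the two
transcendentals of Schanuel may sit entirely on either sort. [folklore] -/
theorem not_schanuelTwoBasePart : ¬ SchanuelTwoBasePart := by
  intro h
  have h1 := h _ linearIndependent_one_sqrt_two
  have halg : ∀ z ∈ Set.range ![(1 : ℂ), ((Real.sqrt 2 : ℝ) : ℂ)], IsAlgebraic ℚ z := by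
    rintro _ ⟨i, rfl⟩; exact isAlgebraic_one_sqrt_two i
  rw [trdeg_adjoin_eq_zero_of_forall_isAlgebraic halg] at h1
  exact absurd h1 (by simp)

/-- Strengthening 4 ("splitting"): the two transcendentals can be localised on one sort. [folklore] -/
def SchanuelTwoSplit : Prop :=
  ∀ x : Fin 2 → ℂ, LinearIndependent ℚ x →
    AlgebraicIndependent ℚ x ∨ AlgebraicIndependent ℚ (Complex.exp ∘ x)

/-- **Splitting FAILS at `x = (iπ, π)`**: `(iπ)² + π² = 0` and `e^{iπ} + 1 = 0`, so neither sort
is algebraically independent — while `SchanuelTwo` HOLDS there (`schanuelTwo_at_piI_pi`,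
Nesterenko: `{π, e^π}`). The transcendence degree in Schanuel genuinely mixes the sorts; a proof
cannot proceed sort by sort. [folklore] -/
theorem not_schanuelTwoSplit : ¬ SchanuelTwoSplit := by
  intro h
  rcases h _ linearIndependent_piI_pi with hx | he
  · -- relation X₀² + X₁² = 0
    have hrel : MvPolynomial.aeval ![(Real.pi : ℂ) * I, (Real.pi : ℂ)]
        (MvPolynomial.X 0 ^ 2 + MvPolynomial.X 1 ^ 2 : MvPolynomial (Fin 2) ℚ) = 0 := by
      simp only [map_add, map_pow, MvPolynomial.aeval_X, Matrix.cons_val_zero, Matrix.cons_val_one,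
        Matrix.cons_val_fin_one]
      ring_nf
      rw [Complex.I_sq]
      ring
    have hzero : (MvPolynomial.X 0 ^ 2 + MvPolynomial.X 1 ^ 2 : MvPolynomial (Fin 2) ℚ) = 0 :=
      hx (by rw [hrel, map_zero])
    have := congrArg (MvPolynomial.eval ![(0 : ℚ), 1]) hzero
    simp at this
  · -- relation X₀ + 1 = 0
    have hrel : MvPolynomial.aeval (Complex.exp ∘ ![(Real.pi : ℂ) * I, (Real.pi : ℂ)])
        (MvPolynomial.X 0 + 1 : MvPolynomial (Fin 2) ℚ) = 0 := by
      simp only [map_add, map_one, MvPolynomial.aeval_X, Function.comp_apply, Matrix.cons_val_zero,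
        Complex.exp_pi_mul_I]
      ring
    have hzero : (MvPolynomial.X 0 + 1 : MvPolynomial (Fin 2) ℚ) = 0 :=
      he (by rw [hrel, map_zero])
    have := congrArg (MvPolynomial.eval ![(0 : ℚ), 0]) hzero
    simp at this


/-- Strengthening 5 (re-normalised exponential): Schanuel `n = 2` for `2^z = e^{z log 2}` in
place of `e^z`, with the same `ℚ`-linear-independence hypothesis. [folklore] -/
def SchanuelTwoBaseTwo : Prop :=
  ∀ x : Fin 2 → ℂ, LinearIndependent ℚ x → (2 : Cardinal) ≤ Algebra.trdeg ℚ
    (adjoin ℚ (Set.range x ∪ Set.range (fun i => cexp (x i * (Real.log 2 : ℂ)))))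

/-- `(1, πi / log 2)` is `ℚ`-linearly independent (real and imaginary parts). [folklore] -/
theorem linearIndependent_one_piI_div_log_two :
    LinearIndependent ℚ ![(1 : ℂ), (Real.pi : ℂ) * I / (Real.log 2 : ℂ)] := by
  have hlog : Real.log 2 ≠ 0 := (Real.log_pos one_lt_two).ne'
  rw [LinearIndependent.pair_iff]
  intro s t hst
  have hdiv : (Real.pi : ℂ) * I / (Real.log 2 : ℂ) = ((Real.pi / Real.log 2 : ℝ) : ℂ) * I := by
    push_cast
    ring
  rw [hdiv] at hst
  have hre := congrArg Complex.re hst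
  have him := congrArg Complex.im hst
  simp only [Complex.add_re, Complex.add_im, Complex.smul_re, Complex.smul_im, Complex.mul_re,
    Complex.mul_im, Complex.ofReal_re, Complex.ofReal_im, Complex.I_re, Complex.I_im,
    Complex.one_re, Complex.one_im, Complex.zero_re, Complex.zero_im, mul_zero, mul_one,
    sub_zero, add_zero, zero_add, smul_zero] at hre him
  constructor
  · rw [Rat.smul_def, mul_one] at hre
    exact_mod_cast hre
  · rw [Rat.smul_def, mul_eq_zero] at him
    rcases him with h | h
    · exact_mod_cast h
    · exact absurd h (div_ne_zero Real.pi_ne_zero hlog)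

/-- **Base 2 FAILS at `x = (1, πi / log 2)`**: `2^x = (2, −1)`, so `ℚ(x, 2^x) = ℚ(πi / log 2)` has
transcendence degree `≤ 1`. The crux is specific to `exp` with its period `2πi` and transcendental
`e = exp 1`: re-normalising so that "`exp 1`" is algebraic (here `2`) and the kernel generator is
`2πi / log 2` reproduces, inside `ℂ`, the kernel-relation mechanism of §7. [folklore] -/
theorem not_schanuelTwoBaseTwo : ¬ SchanuelTwoBaseTwo := by
  intro h
  have hlog : (Real.log 2 : ℂ) ≠ 0 := by exact_mod_cast (Real.log_pos one_lt_two).ne'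
  set x : Fin 2 → ℂ := ![(1 : ℂ), (Real.pi : ℂ) * I / (Real.log 2 : ℂ)] with hxdef
  have h2 := h x linearIndependent_one_piI_div_log_two
  set L : IntermediateField ℚ ℂ := adjoin ℚ ({(Real.pi : ℂ) * I / (Real.log 2 : ℂ)} : Set ℂ) with hL
  have hgen : (Real.pi : ℂ) * I / (Real.log 2 : ℂ) ∈ L := subset_adjoin ℚ _ (Set.mem_singleton _)
  have hle : adjoin ℚ (Set.range x ∪ Set.range (fun i => cexp (x i * (Real.log 2 : ℂ)))) ≤ L := by
    rw [adjoin_le_iff]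
    rintro z (⟨i, rfl⟩ | ⟨i, rfl⟩) <;> fin_cases i
    · simp only [hxdef, Fin.zero_eta, Fin.isValue, Matrix.cons_val_zero, SetLike.mem_coe]
      exact one_mem _
    · simp only [hxdef, Fin.mk_one, Fin.isValue, Matrix.cons_val_one, Matrix.cons_val_fin_one,
        SetLike.mem_coe]
      exact hgen
    · simp only [hxdef, Fin.zero_eta, Fin.isValue, Matrix.cons_val_zero, one_mul, SetLike.mem_coe]
      rw [← Complex.ofReal_exp, Real.exp_log two_pos]
      exact ofNat_mem _ 2
    · simp only [hxdef, Fin.mk_one, Fin.isValue, Matrix.cons_val_one, Matrix.cons_val_fin_one,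
        SetLike.mem_coe]
      rw [div_mul_cancel₀ _ hlog, Complex.exp_pi_mul_I]
      exact neg_mem (one_mem _)
  have := (h2.trans (trdeg_mono hle)).trans (trdeg_adjoin_singleton_le_one (K := ℚ) _)
  exact Nat.not_ofNat_le_one this

/-! ### §5 Profile of a counterexample -/

/-- **Hermite–Lindemann floor** (PROVED in tree, `transcendental_exp_holds`): every `ℚ`-linearly
independent pair has `trdeg ℚ(x, e^x) ≥ 1` (`x₀ ≠ 0`, so `x₀` or `e^{x₀}` is transcendental).
[cite: BakerTNT1975, Ch. 1 Theorem 1.4] -/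
theorem one_le_trdeg_of_linearIndependent (x : Fin 2 → ℂ) (hx : LinearIndependent ℚ x) :
    (1 : Cardinal) ≤ Algebra.trdeg ℚ (SF x) := by
  have hx0 : x 0 ≠ 0 := hx.ne_zero 0
  obtain ⟨t, htK, ht⟩ : ∃ t : ℂ, t ∈ SF x ∧ Transcendental ℚ t := by
    by_cases halg : IsAlgebraic ℚ (x 0)
    · exact ⟨cexp (x 0), subset_adjoin _ _ (Or.inr ⟨0, rfl⟩),
        Literature.NumberTheory.Transcendental.transcendental_exp_holds halg hx0⟩
    · exact ⟨x 0, subset_adjoin _ _ (Or.inl ⟨0, rfl⟩), halg⟩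
  haveI : Algebra.Transcendental ℚ (SF x) :=
    ⟨⟨⟨t, htK⟩, fun h => ht (IntermediateField.isAlgebraic_iff.mp h)⟩⟩
  exact Cardinal.one_le_iff_pos.mpr (trdeg_pos ℚ _)

/-- In `Cardinal`, `1 ≤ t` gives `2 ≤ t ↔ t ≠ 1`. [folklore] -/
theorem two_le_iff_ne_one_of_one_le {t : Cardinal} (h1 : 1 ≤ t) : 2 ≤ t ↔ t ≠ 1 := by
  constructor
  · rintro h rfl
    exact Nat.not_ofNat_le_one h
  · intro hne
    by_contra hlt
    have ht2 : t < 2 := not_le.mp hlt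
    have h2al : (2 : Cardinal) < Cardinal.aleph0 := by
      exact_mod_cast Cardinal.natCast_lt_aleph0 (n := 2)
    obtain ⟨n, rfl⟩ := Cardinal.lt_aleph0.1 (ht2.trans h2al)
    have h1' : 1 ≤ n := by exact_mod_cast h1
    have h2' : n < 2 := by exact_mod_cast ht2
    have h3' : n ≠ 1 := fun hn => hne (by rw [hn]; norm_num)
    omega

/-- **The crux says exactly: the transcendence degree is never `1`.** [folklore] -/
theorem schanuelTwo_iff_trdeg_ne_one :
    SchanuelTwo ↔ ∀ x : Fin 2 → ℂ, LinearIndependent ℚ x → Algebra.trdeg ℚ (SF x) ≠ 1 :=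
  forall₂_congr fun x hx => two_le_iff_ne_one_of_one_le (one_le_trdeg_of_linearIndependent x hx)

/-- **Profile of a counterexample** (what a disproof must exhibit): a `ℚ`-linearly independent
`x` violating the crux has (i) a transcendental coordinate (Lindemann–Weierstrass), (ii) an
algebraic relation among `x₁, x₂` AND one among `e^{x₁}, e^{x₂}` (else two independent elements),
(iii) `trdeg ℚ(x, e^x) = 1` exactly (Hermite–Lindemann). By Kirby 2010 Prop. 7.2 it may moreover
be taken in `ecl(∅)²`. [cite: Kirby2010EAEF, Prop. 7.2] -/
theorem counterexample_profile (x : Fin 2 → ℂ) (hx : LinearIndependent ℚ x)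
    (hlt : ¬ (2 : Cardinal) ≤ Algebra.trdeg ℚ (SF x)) :
    (∃ i, Transcendental ℚ (x i)) ∧ ¬ AlgebraicIndependent ℚ x ∧
      ¬ AlgebraicIndependent ℚ (Complex.exp ∘ x) ∧ Algebra.trdeg ℚ (SF x) = 1 := by
  refine ⟨?_, ?_, ?_, ?_⟩
  · by_contra hno
    refine hlt (schanuelTwo_of_isAlgebraic x (fun i => ?_) hx)
    by_contra hi
    exact hno ⟨i, hi⟩
  · exact fun hind => hlt (schanuelTwo_of_algebraicIndependent x hind)
  · exact fun hind => hlt (two_le_trdeg_of_algebraicIndependent hind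
      fun i => subset_adjoin ℚ _ (Or.inr ⟨i, rfl⟩))
  · by_contra hne
    exact hlt ((two_le_iff_ne_one_of_one_le (one_le_trdeg_of_linearIndependent x hx)).mpr hne)

/-! ### §6 Reductions: equivalent dress, and the named open instances as consequences -/

/-- `SchanuelTwo` is `SchanuelRank 2` of `RoyCriterion.lean` (numeral cast only). [folklore] -/
theorem schanuelTwo_iff_schanuelRank_two :
    SchanuelTwo ↔ Literature.NumberTheory.Transcendental.SchanuelRank 2 := by
  unfold Summit.Schanuel.Schanuel.Theses.RoyCriterion.SchanuelTwo
    Literature.NumberTheory.Transcendental.SchanuelRank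
  simp

/-- **`SchanuelTwo ↔ RoyCriterion 2`** (Roy 2001, Conjecture 2 in rank 2: small values of
`D^k P_N` at `(m₁y₁ + m₂y₂, α₁^{m₁}α₂^{m₂})` force `trdeg ℚ(y, α) ≥ 2`), by the tree's PROVED
equivalence `Roy2001_iff_holds`. A refutation of the crux is therefore also a point
`(y, α) ∈ ℂ² × (ℂˣ)²` with `y` `ℚ`-linearly independent, `trdeg ℚ(y, α) ≤ 1`, carrying Roy's
auxiliary polynomials — equally out of reach. [cite: Roy2001, Conjecture 2 and Theorem 1] -/
theorem schanuelTwo_iff_royCriterion_two :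
    SchanuelTwo ↔ Literature.NumberTheory.Transcendental.RoyCriterion 2 :=
  schanuelTwo_iff_schanuelRank_two.trans
    (Literature.NumberTheory.Transcendental.Roy2001_iff_holds 2).symm

/-- **`SchanuelTwo ⟹ e and π are algebraically independent`** (the flagship OPEN instance,
`x = (1, πi)`; even the irrationality of `e + π` is open). The conclusion is, unfolded (`Iff.rfl`),
the tree's open statement `Literature.NumberTheory.Transcendental.ExpOnePiAlgebraicIndependent`;
CONDITIONAL on the crux — an algebraic relation `P(e, π) = 0` would refute the crux.
[cite: BakerTNT1975, Ch. 12 p. 120] -/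
theorem schanuelTwo_imp_expOnePi (hS : SchanuelTwo) :
    AlgebraicIndependent ℚ ![Real.exp 1, Real.pi] := by
  have h2 := hS _ Literature.Barriers.Schanuel.linearIndependent_one_piI
  set l : Fin 2 → ℂ := fun i => ((![Real.exp 1, Real.pi] i : ℝ) : ℂ) with hldef
  have he : ((Real.exp 1 : ℝ) : ℂ) ∈ adjoin ℚ (Set.range l ∪ {I}) :=
    subset_adjoin ℚ _ (Or.inl ⟨0, by simp [hldef]⟩)
  have hpi : (Real.pi : ℂ) ∈ adjoin ℚ (Set.range l ∪ {I}) :=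
    subset_adjoin ℚ _ (Or.inl ⟨1, by simp [hldef]⟩)
  have hI : I ∈ adjoin ℚ (Set.range l ∪ {I}) := subset_adjoin ℚ _ (Or.inr rfl)
  have hle : SF ![(1 : ℂ), (Real.pi : ℂ) * I] ≤ adjoin ℚ (Set.range l ∪ {I}) := by
    refine SF_le ?_ ?_ ?_ ?_
    · simp only [Matrix.cons_val_zero]; exact one_mem _
    · simp only [Matrix.cons_val_one, Matrix.cons_val_fin_one]; exact mul_mem hpi hI
    · simp only [Matrix.cons_val_zero]
      rw [show cexp 1 = ((Real.exp 1 : ℝ) : ℂ) by rw [Complex.ofReal_exp]; simp]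
      exact he
    · simp only [Matrix.cons_val_one, Matrix.cons_val_fin_one, Complex.exp_pi_mul_I]
      exact neg_mem (one_mem _)
  have h2' : ((2 : ℕ) : Cardinal) ≤ Algebra.trdeg ℚ (adjoin ℚ (Set.range l)) := by
    have h := (h2.trans (trdeg_mono hle)).trans_eq
      (Literature.Barriers.Schanuel.trdeg_adjoin_union_eq_of_isAlgebraic (Set.range l) {I}
        (fun x hx => by
          rw [Set.mem_singleton_iff.mp hx]
          exact Literature.Barriers.Schanuel.isAlgebraic_I))
    exact_mod_cast h
  have hC : AlgebraicIndependent ℚ l :=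
    Literature.Barriers.Schanuel.algebraicIndependent_of_le_trdeg_adjoin l h2'
  exact Literature.Barriers.Schanuel.algebraicIndependent_real_of_complex _ hC

/-- **`SchanuelTwo ⟹ π and log 2 are algebraically independent`** (`x = (πi, log 2)`,
`e^x = (−1, 2)` algebraic, so the whole transcendence degree sits on `ℚ(πi, log 2)`). OPEN; an
algebraic relation between `π` and `log 2` would refute the crux. [cite: Roy1992, Introduction p. 22] -/
theorem schanuelTwo_imp_piI_log_two (hS : SchanuelTwo) :
    AlgebraicIndependent ℚ ![(Real.pi : ℂ) * I, (Real.log 2 : ℂ)] := by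
  have h2 := hS _ Literature.Barriers.Schanuel.linearIndependent_piI_log_two
  have hT : ∀ z ∈ Set.range (Complex.exp ∘ ![(Real.pi : ℂ) * I, (Real.log 2 : ℂ)]),
      IsAlgebraic ℚ z := by
    rintro _ ⟨i, rfl⟩
    fin_cases i
    · simp only [Fin.zero_eta, Fin.isValue, Function.comp_apply, Matrix.cons_val_zero,
        Complex.exp_pi_mul_I]
      simpa using isAlgebraic_algebraMap (R := ℚ) (A := ℂ) (-1)
    · simp only [Fin.mk_one, Fin.isValue, Function.comp_apply, Matrix.cons_val_one,
        Matrix.cons_val_fin_one]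
      rw [← Complex.ofReal_exp, Real.exp_log two_pos]
      simpa using isAlgebraic_algebraMap (R := ℚ) (A := ℂ) 2
  have h2' : ((2 : ℕ) : Cardinal) ≤
      Algebra.trdeg ℚ (adjoin ℚ (Set.range ![(Real.pi : ℂ) * I, (Real.log 2 : ℂ)])) := by
    have h := h2.trans_eq (Literature.Barriers.Schanuel.trdeg_adjoin_union_eq_of_isAlgebraic _ _ hT)
    exact_mod_cast h
  exact Literature.Barriers.Schanuel.algebraicIndependent_of_le_trdeg_adjoin _ h2'

/-- **`SchanuelTwo ⟹ the conjecture on algebraic independence of logarithms in rank 2`**: any two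
`ℚ`-linearly independent logarithms of algebraic numbers are algebraically independent (the
`n = 2` slice of `Literature.Barriers.Schanuel.AlgIndepLogarithms`; OPEN — "it is not even known
whether there exist two elements of `L` which are algebraically independent", Roy 1992). Baker's
theorem gives only `ℚ̄`-LINEAR independence here (barrier
`Literature.Barriers.Schanuel.AlgebraicIndependenceOfLogarithms`). [cite: Roy1992, Introduction p. 22] -/
theorem schanuelTwo_imp_algIndepLogarithms_two (hS : SchanuelTwo) (l : Fin 2 → ℂ)
    (halg : ∀ i, IsAlgebraic ℚ (cexp (l i))) (hli : LinearIndependent ℚ l) :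
    AlgebraicIndependent ℚ l := by
  have hT : ∀ z ∈ Set.range (Complex.exp ∘ l), IsAlgebraic ℚ z := by
    rintro _ ⟨i, rfl⟩; exact halg i
  have h2' : ((2 : ℕ) : Cardinal) ≤ Algebra.trdeg ℚ (adjoin ℚ (Set.range l)) := by
    have h := (hS l hli).trans_eq
      (Literature.Barriers.Schanuel.trdeg_adjoin_union_eq_of_isAlgebraic _ _ hT)
    exact_mod_cast h
  exact Literature.Barriers.Schanuel.algebraicIndependent_of_le_trdeg_adjoin _ h2'


/-- `(1, e)` is `ℚ`-linearly independent (`e` is transcendental: Hermite; tree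
`transcendental_exp_holds` at `α = 1`). [cite: BakerTNT1975, Ch. 1 Theorem 1.2] -/
theorem linearIndependent_one_exp_one : LinearIndependent ℚ ![(1 : ℂ), cexp 1] :=
  (Literature.Barriers.Schanuel.linearIndependent_pair_of_transcendental
    (Literature.NumberTheory.Transcendental.transcendental_exp_holds
      (isAlgebraic_one (R := ℚ) (A := ℂ)) one_ne_zero)).2

/-- **`SchanuelTwo ⟹ e and e^e are algebraically independent`** (`x = (1, e)`; OPEN — not even
the irrationality of `e^e` is known; Brownawell–Waldschmidt give only "`e^e` or `e^{e²}` is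
transcendental"). An algebraic relation between `e` and `e^e` would refute the crux.
[cite: BakerTNT1975, Ch. 12 Theorem 12.2 (Brownawell–Waldschmidt)] -/
theorem schanuelTwo_imp_e_exp_e (hS : SchanuelTwo) :
    AlgebraicIndependent ℚ ![cexp 1, cexp (cexp 1)] := by
  have h2 := hS _ linearIndependent_one_exp_one
  set l : Fin 2 → ℂ := ![cexp 1, cexp (cexp 1)] with hl
  have he : cexp 1 ∈ adjoin ℚ (Set.range l) := subset_adjoin ℚ _ ⟨0, by simp [hl]⟩
  have hee : cexp (cexp 1) ∈ adjoin ℚ (Set.range l) := subset_adjoin ℚ _ ⟨1, by simp [hl]⟩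
  have hle : SF ![(1 : ℂ), cexp 1] ≤ adjoin ℚ (Set.range l) := by
    refine SF_le ?_ ?_ ?_ ?_
    · simp only [Matrix.cons_val_zero]; exact one_mem _
    · simp only [Matrix.cons_val_one, Matrix.cons_val_fin_one]; exact he
    · simp only [Matrix.cons_val_zero]; exact he
    · simp only [Matrix.cons_val_one, Matrix.cons_val_fin_one]; exact hee
  have h2' : ((2 : ℕ) : Cardinal) ≤ Algebra.trdeg ℚ (adjoin ℚ (Set.range l)) := by
    exact_mod_cast h2.trans (trdeg_mono hle)
  exact algebraicIndependent_of_le_trdeg_adjoin l h2'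

/-- `(log 2, √2 · log 2)` is `ℚ`-linearly independent (irrationality of `√2`, `log 2 ≠ 0`). [folklore] -/
theorem linearIndependent_log_two_sqrt_two_mul_log_two :
    LinearIndependent ℚ ![(Real.log 2 : ℂ), ((Real.sqrt 2 : ℝ) : ℂ) * (Real.log 2 : ℂ)] := by
  have hlog : (Real.log 2 : ℂ) ≠ 0 := by exact_mod_cast (Real.log_pos one_lt_two).ne'
  rw [LinearIndependent.pair_iff]
  intro s t hst
  have key : s • (1 : ℂ) + t • ((Real.sqrt 2 : ℝ) : ℂ) = 0 := by
    have h' : (s • (1 : ℂ) + t • ((Real.sqrt 2 : ℝ) : ℂ)) * (Real.log 2 : ℂ) = 0 := by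
      rw [add_mul, smul_mul_assoc, smul_mul_assoc, one_mul]
      exact hst
    exact (mul_eq_zero.mp h').resolve_right hlog
  exact LinearIndependent.pair_iff.mp linearIndependent_one_sqrt_two s t key

/-- **`SchanuelTwo ⟹ log 2 and 2^{√2} are algebraically independent`** (`x = (log 2, √2 log 2)`,
`e^x = (2, 2^{√2})`; OPEN — Gel'fond–Schneider gives only the transcendence of `2^{√2}`). An
algebraic relation between `log 2` and `2^{√2} = e^{√2 log 2}` would refute the crux.
[cite: BakerTNT1975, Ch. 2 Theorem 2.1 (Gel'fond–Schneider)] -/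
theorem schanuelTwo_imp_log_two_two_pow_sqrt_two (hS : SchanuelTwo) :
    AlgebraicIndependent ℚ ![(Real.log 2 : ℂ), cexp (((Real.sqrt 2 : ℝ) : ℂ) * (Real.log 2 : ℂ))] := by
  have h2 := hS _ linearIndependent_log_two_sqrt_two_mul_log_two
  set l : Fin 2 → ℂ := ![(Real.log 2 : ℂ), cexp (((Real.sqrt 2 : ℝ) : ℂ) * (Real.log 2 : ℂ))] with hl
  have hlg : (Real.log 2 : ℂ) ∈ adjoin ℚ (Set.range l ∪ {((Real.sqrt 2 : ℝ) : ℂ)}) :=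
    subset_adjoin ℚ _ (Or.inl ⟨0, by simp [hl]⟩)
  have hpw : cexp (((Real.sqrt 2 : ℝ) : ℂ) * (Real.log 2 : ℂ)) ∈
      adjoin ℚ (Set.range l ∪ {((Real.sqrt 2 : ℝ) : ℂ)}) :=
    subset_adjoin ℚ _ (Or.inl ⟨1, by simp [hl]⟩)
  have hs2 : ((Real.sqrt 2 : ℝ) : ℂ) ∈ adjoin ℚ (Set.range l ∪ {((Real.sqrt 2 : ℝ) : ℂ)}) :=
    subset_adjoin ℚ _ (Or.inr rfl)
  have hle : SF ![(Real.log 2 : ℂ), ((Real.sqrt 2 : ℝ) : ℂ) * (Real.log 2 : ℂ)] ≤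
      adjoin ℚ (Set.range l ∪ {((Real.sqrt 2 : ℝ) : ℂ)}) := by
    refine SF_le ?_ ?_ ?_ ?_
    · simp only [Matrix.cons_val_zero]; exact hlg
    · simp only [Matrix.cons_val_one, Matrix.cons_val_fin_one]; exact mul_mem hs2 hlg
    · simp only [Matrix.cons_val_zero]
      rw [← Complex.ofReal_exp, Real.exp_log two_pos]
      exact ofNat_mem _ 2
    · simp only [Matrix.cons_val_one, Matrix.cons_val_fin_one]; exact hpw
  have h2' : ((2 : ℕ) : Cardinal) ≤ Algebra.trdeg ℚ (adjoin ℚ (Set.range l)) := by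
    have h := (h2.trans (trdeg_mono hle)).trans_eq
      (trdeg_adjoin_union_eq_of_isAlgebraic (Set.range l) {((Real.sqrt 2 : ℝ) : ℂ)}
        (fun z hz => by
          rw [Set.mem_singleton_iff.mp hz]
          exact isAlgebraic_one_sqrt_two 1))
    exact_mod_cast h
  exact algebraicIndependent_of_le_trdeg_adjoin l h2'


/-- **`SchanuelTwo ⟹ e^{π²} is transcendental`** (`x = (πi, π²)`: if `e^{π²} ∈ ℚ̄` then `πi`,
`π²` are `ℚ`-linearly independent logarithms of algebraic numbers with `(πi)² + π² = 0`,
contradicting `schanuelTwo_imp_algIndepLogarithms_two`). OPEN — Waldschmidt's Exemple 26; Baker: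
Theorems 12.1–12.3 "represent the nearest approach we have to date towards … the transcendence of
numbers of the type `log π` and `e^{π²}`". A FIFTH refutation target: `e^{π²} ∈ ℚ̄` kills the crux.
[cite: Waldschmidt2005Periodes, §8.1 Conjecture 25 and Exemple 26] [cite: BakerTNT1975, Ch. 12 §1 p. 119] -/
theorem schanuelTwo_imp_transcendental_exp_pi_sq (hS : SchanuelTwo) :
    Transcendental ℚ (Real.exp (Real.pi ^ 2)) := by
  intro halg
  have hv : AlgebraicIndependent ℚ ![(Real.pi : ℂ) * I, ((Real.pi ^ 2 : ℝ) : ℂ)] := by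
    refine schanuelTwo_imp_algIndepLogarithms_two hS _ ?_
      Literature.Barriers.Schanuel.linearIndependent_piI_pi_sq
    intro i
    fin_cases i
    · simp only [Fin.zero_eta, Fin.isValue, Matrix.cons_val_zero, Complex.exp_pi_mul_I]
      simpa using isAlgebraic_algebraMap (R := ℚ) (A := ℂ) (-1)
    · simp only [Fin.mk_one, Fin.isValue, Matrix.cons_val_one, Matrix.cons_val_fin_one]
      rw [← Complex.ofReal_exp]
      exact halg.algebraMap
  have hrel : MvPolynomial.aeval ![(Real.pi : ℂ) * I, ((Real.pi ^ 2 : ℝ) : ℂ)]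
      (MvPolynomial.X 0 ^ 2 + MvPolynomial.X 1 : MvPolynomial (Fin 2) ℚ) = 0 := by
    simp only [map_add, map_pow, MvPolynomial.aeval_X, Matrix.cons_val_zero, Matrix.cons_val_one,
      Matrix.cons_val_fin_one]
    push_cast
    ring_nf
    rw [Complex.I_sq]
    ring
  have hzero : (MvPolynomial.X 0 ^ 2 + MvPolynomial.X 1 : MvPolynomial (Fin 2) ℚ) = 0 :=
    hv (by rw [hrel, map_zero])
  have := congrArg (MvPolynomial.eval ![(0 : ℚ), 1]) hzero
  simp at this

/-! ### §7 Barrier reduction: the crux is not "soft" (Bays–Kirby 2018, §9.2)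

`SchanuelTwo` is the `n = 2` slice of the Schanuel PROPERTY of the exponential field `ℂ_exp`. In
Bays–Kirby's pseudo-exponential fields `𝔹_P` — algebraically closed of cardinality `𝔠`, standard
kernel `ℤτ`, exponential-algebraic closedness, countable closure, quasiminimal: every axiom of
Zilber's `𝔹` except Schanuel — already THIS slice fails, at the pair `(1, τ)` (`exp τ = 1`,
`P(exp 1, τ) = 0`). So no argument from those properties of `ℂ_exp` alone reaches the crux
(barrier `Literature.Barriers.Schanuel.AxiomsDoNotForceSchanuel`): a proof must use analytic /
arithmetic (height) input about the actual complex exponential. -/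

/-- The `n = 2` Schanuel property of an abstract exponential field. [cite: BaysKirby2018ANT, §9.1 Theorem 9.1 (axiom 3)] -/
def SchanuelTwoIn (F : Type*) [Field F] [CharZero F]
    [Literature.ModelTheory.ExponentialFields.ExponentialRing F] : Prop :=
  ∀ x : Fin 2 → F, LinearIndependent ℚ x → (2 : Cardinal) ≤ Algebra.trdeg ℚ
    ↥(adjoin ℚ (Set.range x ∪ Set.range (Literature.ModelTheory.ExponentialFields.ExponentialRing.exp ∘ x)))

/-- For `ℂ_exp` this is the crux, definitionally. [folklore] -/
theorem schanuelTwoIn_complex_iff : SchanuelTwoIn ℂ ↔ SchanuelTwo := Iff.rfl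

/-- **A kernel relation kills the `n = 2` slice** (the mechanism of the barrier, specialised: the
tree's `not_schanuelProperty_of_kernel_relation` uses the Schanuel property only at `n = 2`): if
`τ` is transcendental, `exp τ = 1` and `P(exp 1, τ) = 0` for some `P ≠ 0`, then `SchanuelTwoIn F`
fails at `x = (1, τ)`. [cite: BaysKirby2018ANT, §9.2] -/
theorem not_schanuelTwoIn_of_kernel_relation {F : Type*} [Field F] [CharZero F]
    [Literature.ModelTheory.ExponentialFields.ExponentialRing F] {τ : F} (hτ : Transcendental ℚ τ)
    (hker : Literature.ModelTheory.ExponentialFields.ExponentialRing.exp τ = 1)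
    {P : MvPolynomial (Fin 2) ℤ} (hP : P ≠ 0)
    (hrel : MvPolynomial.aeval
      ![Literature.ModelTheory.ExponentialFields.ExponentialRing.exp (1 : F), τ] P = 0) :
    ¬ SchanuelTwoIn F := by
  intro hS2
  have h2 := hS2 ![(1 : F), τ] (Literature.Barriers.Schanuel.linearIndependent_one_tau hτ)
  set l : Fin 2 → F := ![Literature.ModelTheory.ExponentialFields.ExponentialRing.exp (1 : F), τ]
    with hl
  have hle : adjoin ℚ (Set.range ![(1 : F), τ] ∪
      Set.range (Literature.ModelTheory.ExponentialFields.ExponentialRing.exp ∘ ![(1 : F), τ]))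
      ≤ adjoin ℚ (Set.range l) := by
    rw [adjoin_le_iff]
    rintro w (⟨i, rfl⟩ | ⟨i, rfl⟩) <;> fin_cases i
    · simp
    · simpa using subset_adjoin ℚ (Set.range l) ⟨1, by simp [hl]⟩
    · simp only [Fin.zero_eta, Fin.isValue, Function.comp_apply, Matrix.cons_val_zero,
        SetLike.mem_coe]
      exact subset_adjoin ℚ (Set.range l) ⟨0, by simp [hl]⟩
    · simp [hker]
  have h2' : ((2 : ℕ) : Cardinal) ≤ Algebra.trdeg ℚ (adjoin ℚ (Set.range l)) := by
    exact_mod_cast h2.trans (trdeg_mono hle)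
  have hind : AlgebraicIndependent ℚ l := algebraicIndependent_of_le_trdeg_adjoin l h2'
  have hPQ : MvPolynomial.map (Int.castRingHom ℚ) P ≠ 0 := by
    intro h0
    apply hP
    exact MvPolynomial.map_injective (Int.castRingHom ℚ) Int.cast_injective (by simpa using h0)
  apply hPQ
  apply hind
  rw [map_zero]
  have : MvPolynomial.aeval l (MvPolynomial.map (Int.castRingHom ℚ) P) = MvPolynomial.aeval l P := by
    rw [show Int.castRingHom ℚ = algebraMap ℤ ℚ from rfl, MvPolynomial.aeval_map_algebraMap]
  rw [this]
  exact hrel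

/-- **The crux fails in a soft Zilber field** (from Bays–Kirby's named fact
`baysKirby2018_modelsWithoutSchanuel`, Thm 1.7 + Thm 8.2 + §9.2, with `P = x − y`): there is an
exponential field with all of Zilber's axioms but Schanuel (`IsSoftZilberField`) in which the
`n = 2` slice is FALSE. Hence `SchanuelTwo` is not a consequence of those axioms for `ℂ_exp`.
[cite: BaysKirby2018ANT, §9.2] -/
theorem exists_isSoftZilberField_not_schanuelTwoIn
    (h : Literature.Barriers.Schanuel.baysKirby2018_modelsWithoutSchanuel) :
    ∃ (F : Type) (_ : Field F) (_ : CharZero F)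
      (_ : Literature.ModelTheory.ExponentialFields.ExponentialRing F),
      Literature.Barriers.Schanuel.IsSoftZilberField F ∧ ¬ SchanuelTwoIn F := by
  obtain ⟨F, _, _, _, hcard, hac, hsurj, ⟨τ, hτ, hker, -, hrel⟩, hlin, hccp, hqm⟩ :=
    h _ Literature.Barriers.Schanuel.isAdmissibleRelation_X_sub_X
  have hτker : Literature.ModelTheory.ExponentialFields.ExponentialRing.exp τ = 1 := by
    rw [← Literature.ModelTheory.ExponentialFields.ExponentialRing.mem_expKernel_iff, hker]
    exact AddSubgroup.mem_zmultiples τ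
  exact ⟨F, inferInstance, inferInstance, inferInstance,
    ⟨hcard, hac, hsurj, ⟨τ, hτ, hker⟩, hlin, hccp, hqm⟩,
    not_schanuelTwoIn_of_kernel_relation hτ hτker
      Literature.Barriers.Schanuel.isAdmissibleRelation_X_sub_X.1.ne_zero hrel⟩


/-! ### §8 Where to look: Kirby's reduction in rank `≤ 2` (counterexamples may be taken in `ecl(∅)²`)

Kirby 2010, Prop. 7.2 (essential counterexamples to the Schanuel property lie in `ecl(∅)`) is in
the tree for the whole conjecture (`schanuelConjecture_iff_ecl_empty_holds`, from Ax's theorem).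
Its proof lowers the rank, never raises it, so it slices: `SchanuelTwo` is equivalent to its
restriction to pairs of EXPONENTIALLY ALGEBRAIC numbers (`schanuelTwo_iff_ecl`), a countable set —
the only place a disproof can live (and where the four classical pairs do live,
`Literature.Barriers.Schanuel.classicalPairs_mem_ecl_empty`). -/

/-- Hermite–Lindemann floor in any rank: a `ℚ`-linearly independent family with an index has
`trdeg ℚ(x, e^x) ≥ 1`. [cite: BakerTNT1975, Ch. 1 Theorem 1.4] -/
theorem one_le_trdeg_of_linearIndependent' {n : ℕ} (x : Fin n → ℂ) (i : Fin n)
    (hx : LinearIndependent ℚ x) :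
    (1 : Cardinal) ≤ Algebra.trdeg ℚ (adjoin ℚ (Set.range x ∪ Set.range (Complex.exp ∘ x))) := by
  have hx0 : x i ≠ 0 := hx.ne_zero i
  obtain ⟨t, htK, ht⟩ : ∃ t : ℂ, t ∈ adjoin ℚ (Set.range x ∪ Set.range (Complex.exp ∘ x)) ∧
      Transcendental ℚ t := by
    by_cases halg : IsAlgebraic ℚ (x i)
    · exact ⟨cexp (x i), subset_adjoin _ _ (Or.inr ⟨i, rfl⟩),
        Literature.NumberTheory.Transcendental.transcendental_exp_holds halg hx0⟩
    · exact ⟨x i, subset_adjoin _ _ (Or.inl ⟨i, rfl⟩), halg⟩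
  haveI : Algebra.Transcendental ℚ (adjoin ℚ (Set.range x ∪ Set.range (Complex.exp ∘ x))) :=
    ⟨⟨⟨t, htK⟩, fun h => ht (IntermediateField.isAlgebraic_iff.mp h)⟩⟩
  exact Cardinal.one_le_iff_pos.mpr (trdeg_pos ℚ _)

/-- `SchanuelTwo` restricted to pairs from `ecl(∅)` (exponentially algebraic numbers: coordinates
of non-singular zeros of Khovanskii systems; contains `ℚ̄`, `e`, `π i`, `log ℚ̄ˣ`, and is an
exp-closed countable subfield). [cite: Kirby2010EAEF, Def. 3.1 and Prop. 7.2] -/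
def SchanuelTwoEcl : Prop :=
  ∀ x : Fin 2 → ℂ, (∀ i, x i ∈ Literature.NumberTheory.Transcendental.ecl (∅ : Set ℂ)) →
    LinearIndependent ℚ x → (2 : Cardinal) ≤ Algebra.trdeg ℚ (SF x)

open Submodule Literature.NumberTheory.Transcendental in
/-- **Kirby's reduction, bounded rank** (the proof of `schanuelConjecture_iff_ecl_empty_of_kirby`
run below a rank bound `N`; inputs: Kirby's Thm 1.2 over `ecl ∅`, PROVED in tree as
`kirby_relative_schanuel_complex_holds`, and Lemma 3.3, `Kirby2010_ecl_isExpSubfield_holds`): if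
Schanuel holds for `ecl(∅)`-tuples of every rank `≤ N` then it holds for all tuples of rank `≤ N`.
[cite: Kirby2010EAEF, Prop. 7.2] -/
theorem schanuelRank_of_ecl_le (N : ℕ)
    (H : ∀ k, k ≤ N → ∀ y : Fin k → ℂ, (∀ i, y i ∈ ecl (∅ : Set ℂ)) → LinearIndependent ℚ y →
      (k : Cardinal) ≤ Algebra.trdeg ℚ (adjoin ℚ (Set.range y ∪ Set.range (Complex.exp ∘ y))))
    (n : ℕ) (hnN : n ≤ N) : Literature.NumberTheory.Transcendental.SchanuelRank n := by
  have hrel := kirby_relative_schanuel_complex_holds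
  have hE := Kirby2010_ecl_isExpSubfield_holds ℂ
  intro x hx
  obtain ⟨⟨SE, hSE⟩, hexp⟩ := hE ∅
  let Eq : Submodule ℚ ℂ :=
    { carrier := ecl (∅ : Set ℂ)
      add_mem' := fun {a b} ha hb => by
        rw [← hSE] at ha hb ⊢; exact SE.add_mem ha hb
      zero_mem' := by rw [← hSE]; exact SE.zero_mem
      smul_mem' := fun q {a} ha => by
        rw [← hSE] at ha ⊢
        rw [Rat.smul_def]
        exact SE.mul_mem (SubfieldClass.ratCast_mem SE q) ha }
  have hEq : (Eq : Set ℂ) = ecl (∅ : Set ℂ) := rfl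
  have hspanE : span ℚ (ecl (∅ : Set ℂ)) = Eq := by rw [← hEq, span_eq]
  set V : Submodule ℚ ℂ := span ℚ (Set.range x) with hV
  haveI : FiniteDimensional ℚ V := FiniteDimensional.span_of_finite ℚ (Set.finite_range x)
  set W : Submodule ℚ ℂ := V ⊓ Eq with hW
  obtain ⟨U', hU'⟩ := W.exists_isCompl
  set U : Submodule ℚ ℂ := V ⊓ U' with hU
  haveI : FiniteDimensional ℚ W := Submodule.finiteDimensional_of_le inf_le_left
  haveI : FiniteDimensional ℚ U := Submodule.finiteDimensional_of_le inf_le_left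
  have hWU_sup : W ⊔ U = V := by
    rw [hU, inf_comm, ← sup_inf_assoc_of_le U' (inf_le_left : W ≤ V), hU'.sup_eq_top, top_inf_eq]
  have hWU_disj : Disjoint W U := hU'.disjoint.mono_right inf_le_right
  have hUE_disj : Disjoint U Eq := by
    rw [disjoint_def]
    intro a haU haE
    exact (disjoint_def.mp hWU_disj) a ⟨inf_le_left (b := U') haU, haE⟩ haU
  set k := Module.finrank ℚ W
  set m := Module.finrank ℚ U
  have hn : k + m = n := by
    have h1 := Submodule.finrank_sup_add_finrank_inf_eq W U
    rw [hWU_disj.eq_bot, finrank_bot, add_zero, hWU_sup] at h1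
    rw [← h1, hV, finrank_span_eq_card hx, Fintype.card_fin]
  let bW := Module.finBasis ℚ W
  let bU := Module.finBasis ℚ U
  let y : Fin k → ℂ := fun i => (bW i : ℂ)
  let z : Fin m → ℂ := fun j => (bU j : ℂ)
  have hy_mem : ∀ i, y i ∈ ecl (∅ : Set ℂ) := fun i => ((bW i).2 : (bW i : ℂ) ∈ V ⊓ Eq).2
  have hy_V : ∀ i, y i ∈ V := fun i => ((bW i).2 : (bW i : ℂ) ∈ V ⊓ Eq).1
  have hz_U : ∀ j, z j ∈ U := fun j => (bU j).2
  have hz_V : ∀ j, z j ∈ V := fun j => inf_le_left (b := U') (hz_U j)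
  have hy_li : LinearIndependent ℚ y := bW.linearIndependent.map' W.subtype W.ker_subtype
  have hz_li : LinearIndependent ℚ z := bU.linearIndependent.map' U.subtype U.ker_subtype
  choose Ny hNy hNy_mem using fun i => exists_nsmul_mem_span_int x (hy_V i)
  choose Nz hNz hNz_mem using fun j => exists_nsmul_mem_span_int x (hz_V j)
  let cy : Fin k → ℚˣ := fun i => Units.mk0 (Ny i : ℚ) (Nat.cast_ne_zero.mpr (hNy i))
  let cz : Fin m → ℚˣ := fun j => Units.mk0 (Nz j : ℚ) (Nat.cast_ne_zero.mpr (hNz j))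
  let y' : Fin k → ℂ := fun i => (Ny i : ℚ) • y i
  let z' : Fin m → ℂ := fun j => (Nz j : ℚ) • z j
  have hy'_eq : cy • y = y' := by
    funext i; simp only [Pi.smul_apply', cy, y', Units.smul_def, Units.val_mk0]
  have hz'_eq : cz • z = z' := by
    funext j; simp only [Pi.smul_apply', cz, z', Units.smul_def, Units.val_mk0]
  have hy'_li : LinearIndependent ℚ y' := hy'_eq ▸ hy_li.units_smul cy
  have hz'_li : LinearIndependent ℚ z' := hz'_eq ▸ hz_li.units_smul cz
  have hy'_mem : ∀ i, y' i ∈ ecl (∅ : Set ℂ) := fun i => Eq.smul_mem _ (hy_mem i)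
  have hz'_U : ∀ j, z' j ∈ U := fun j => U.smul_mem _ (hz_U j)
  have hz'_modE : LinearIndependent ℚ ((span ℚ (ecl (∅ : Set ℂ))).mkQ ∘ z') := by
    refine hz'_li.map ?_
    rw [ker_mkQ, hspanE]
    exact hUE_disj.mono_left (span_le.mpr (Set.range_subset_iff.mpr hz'_U))
  set Sy := Set.range y' ∪ Set.range (Complex.exp ∘ y') with hSy
  set Sz := Set.range z' ∪ Set.range (Complex.exp ∘ z') with hSz
  set Ky := adjoin ℚ Sy with hKy
  set L := adjoin ℚ (ecl (∅ : Set ℂ)) with hL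
  have hkN : k ≤ N := by omega
  have hk : (k : Cardinal) ≤ Algebra.trdeg ℚ Ky := H k hkN y' hy'_mem hy'_li
  have hm₀ : (m : Cardinal) ≤ Algebra.trdeg L (adjoin L Sz) := hrel m z' hz'_modE
  have hKyL : Ky ≤ L := by
    rw [hKy, adjoin_le_iff]
    rintro a (⟨i, rfl⟩ | ⟨i, rfl⟩)
    · exact subset_adjoin ℚ _ (hy'_mem i)
    · exact subset_adjoin ℚ _ (hexp _ (hy'_mem i))
  have hm : (m : Cardinal) ≤ Algebra.trdeg Ky (adjoin Ky Sz) :=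
    hm₀.trans (trdeg_adjoin_le_of_le hKyL Sz)
  have hkm : (k : Cardinal) + m ≤ Algebra.trdeg ℚ (adjoin ℚ (Sy ∪ Sz)) :=
    add_le_trdeg_adjoin_union Sy Sz hk hm
  set Kx := adjoin ℚ (Set.range x ∪ Set.range (Complex.exp ∘ x)) with hKx
  have hle : adjoin ℚ (Sy ∪ Sz) ≤ Kx := by
    rw [adjoin_le_iff]
    rintro a ((⟨i, rfl⟩ | ⟨i, rfl⟩) | (⟨j, rfl⟩ | ⟨j, rfl⟩))
    · exact (mem_adjoin_of_mem_span_int x (hNy_mem i)).1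
    · exact (mem_adjoin_of_mem_span_int x (hNy_mem i)).2
    · exact (mem_adjoin_of_mem_span_int x (hNz_mem j)).1
    · exact (mem_adjoin_of_mem_span_int x (hNz_mem j)).2
  have hfin : Algebra.trdeg ℚ (adjoin ℚ (Sy ∪ Sz)) ≤ Algebra.trdeg ℚ Kx :=
    trdeg_le_of_injective (inclusion hle) (inclusion_injective hle)
  calc (n : Cardinal) = (k : Cardinal) + m := by rw [← hn, Nat.cast_add]
    _ ≤ Algebra.trdeg ℚ (adjoin ℚ (Sy ∪ Sz)) := hkm
    _ ≤ Algebra.trdeg ℚ Kx := hfin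

/-- **`SchanuelTwo` ⟺ `SchanuelTwo` on exponentially algebraic pairs** (Kirby's reduction sliced
at rank 2: ranks `0` and `1` of the restricted hypothesis are trivial / Hermite–Lindemann). A
refutation of the crux may therefore be sought in the COUNTABLE set `ecl(∅)²` only.
[cite: Kirby2010EAEF, Prop. 7.2] -/
theorem schanuelTwo_iff_ecl : SchanuelTwo ↔ SchanuelTwoEcl := by
  refine ⟨fun h x _ hx => h x hx, fun H => ?_⟩
  have key := schanuelRank_of_ecl_le 2 ?_ 2 le_rfl
  · exact schanuelTwo_iff_schanuelRank_two.mpr key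
  intro k hk y hy hli
  interval_cases k
  · simp
  · simpa using one_le_trdeg_of_linearIndependent' y 0 hli
  · exact_mod_cast H y hy hli


/-! ### §9 The crux depends only on the `ℚ`-plane `span_ℚ(x)`; planes containing `π` or `π√3` are settled

`trdeg ℚ(x, e^x)` is an invariant of the `ℚ`-subspace `V = span_ℚ(x₁, x₂) ⊂ ℂ` (for `y ∈ V`,
`y ∈ ℚ(x, e^x)` and `e^y` is a root of `X^N − e^{Ny}`, `e^{Ny}` a monomial in the `e^{xᵢ}^{±1}`):
`trdeg_SF_eq_of_span_eq`. So the crux is a statement about points of the Grassmannian of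
`ℚ`-planes in `ℂ` (Zilber's predimension `δ(V) = trdeg ℚ(V, e^V) − dim V ≥ 0`), invariant under
`GL₂(ℚ)`, and the known locus of §2 propagates to whole planes: every plane containing `π`
(`schanuelTwo_of_pi_mem_span`) or `π√3` (`schanuelTwo_of_pi_mul_sqrt_three_mem_span`) satisfies
the crux, by Nesterenko at `τ = i`, resp. `τ = ρ`. -/

/-- Relative algebraic adjunction does not change `trdeg` (copy of
`Literature.Barriers.Schanuel.trdeg_adjoin_union_eq_of_isAlgebraic_adjoin`, whose file carries the
modular-forms cone). [folklore] -/
theorem trdeg_adjoin_union_eq_of_isAlgebraic_adjoin' {K E : Type*} [Field K] [Field E]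
    [Algebra K E] (S T : Set E) (hT : ∀ x ∈ T, IsAlgebraic (adjoin K S) x) :
    Algebra.trdeg K (adjoin K (S ∪ T)) = Algebra.trdeg K (adjoin K S) := by
  haveI : FaithfulSMul (adjoin K S) (adjoin (adjoin K S) T) :=
    (faithfulSMul_iff_algebraMap_injective (adjoin K S) (adjoin (adjoin K S) T)).mpr
      (algebraMap (adjoin K S) (adjoin (adjoin K S) T)).injective
  have htower := trdeg_add_eq K (adjoin K S) (A := adjoin (adjoin K S) T)
  have heq : Algebra.trdeg K (adjoin (adjoin K S) T) = Algebra.trdeg K (adjoin K (S ∪ T)) := by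
    rw [← (equivOfEq (adjoin_adjoin_left K S T)).trdeg_eq]
    rfl
  haveI : Algebra.IsAlgebraic (adjoin K S) (adjoin (adjoin K S) T) :=
    IntermediateField.isAlgebraic_adjoin fun x hx => (hT x hx).isIntegral
  have h0 : Algebra.trdeg (adjoin K S) (adjoin (adjoin K S) T) = 0 := trdeg_eq_zero
  rw [h0, add_zero, heq] at htower
  exact htower.symm

/-- **Two algebraically independent numbers algebraic over `ℚ(x, e^x)` settle the crux at `x`.**
[folklore] -/
theorem two_le_trdeg_SF_of_isAlgebraic_pair (x : Fin 2 → ℂ) {u v : ℂ}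
    (huv : AlgebraicIndependent ℚ ![u, v]) (hu : IsAlgebraic (SF x) u) (hv : IsAlgebraic (SF x) v) :
    (2 : Cardinal) ≤ Algebra.trdeg ℚ (SF x) := by
  have hT : ∀ z ∈ ({u, v} : Set ℂ), IsAlgebraic (SF x) z := by
    rintro z (rfl | hz)
    · exact hu
    · rw [Set.mem_singleton_iff.mp hz]; exact hv
  have heq := trdeg_adjoin_union_eq_of_isAlgebraic_adjoin'
    (Set.range x ∪ Set.range (Complex.exp ∘ x)) {u, v} hT
  have h2 : (2 : Cardinal) ≤ Algebra.trdeg ℚ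
      (adjoin ℚ (Set.range x ∪ Set.range (Complex.exp ∘ x) ∪ {u, v})) := by
    refine two_le_trdeg_of_algebraicIndependent huv ?_
    intro i
    fin_cases i
    · exact subset_adjoin ℚ _ (Or.inr (Set.mem_insert _ _))
    · exact subset_adjoin ℚ _ (Or.inr (Set.mem_insert_of_mem _ (Set.mem_singleton _)))
  exact h2.trans_eq heq

/-- **Elements of the `ℚ`-plane**: for `y ∈ span_ℚ(x)`, `y ∈ ℚ(x, e^x)` and `e^y` is algebraic
over `ℚ(x, e^x)` (`(e^y)^N = e^{Ny} ∈ ℚ(x, e^x)` for a denominator `N` of `y`). [folklore] -/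
theorem mem_SF_and_isAlgebraic_exp_of_mem_span (x : Fin 2 → ℂ) {y : ℂ}
    (hy : y ∈ Submodule.span ℚ (Set.range x)) :
    y ∈ SF x ∧ IsAlgebraic (SF x) (cexp y) := by
  obtain ⟨N, hN, hmem⟩ := Literature.NumberTheory.Transcendental.exists_nsmul_mem_span_int x hy
  obtain ⟨hNy, hexpNy⟩ := Literature.NumberTheory.Transcendental.mem_adjoin_of_mem_span_int x hmem
  have hNq : (N : ℚ) ≠ 0 := Nat.cast_ne_zero.mpr hN
  constructor
  · have hy' : y = ((N : ℚ)⁻¹ : ℚ) • ((N : ℚ) • y) := by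
      rw [smul_smul, inv_mul_cancel₀ hNq, one_smul]
    rw [hy', Rat.smul_def]
    exact mul_mem (SubfieldClass.ratCast_mem (SF x) _) hNy
  · have hpow : cexp y ^ N = cexp ((N : ℚ) • y) := by
      rw [Rat.smul_def, Rat.cast_natCast, Complex.exp_nat_mul]
    refine ⟨Polynomial.X ^ N - Polynomial.C ⟨cexp ((N : ℚ) • y), hexpNy⟩, ?_, ?_⟩
    · exact Polynomial.X_pow_sub_C_ne_zero (Nat.pos_of_ne_zero hN) _
    · simp only [map_sub, map_pow, Polynomial.aeval_X, Polynomial.aeval_C,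
        IntermediateField.algebraMap_apply]
      rw [hpow]
      exact sub_self _

/-- **`trdeg ℚ(x, e^x)` is monotone in the `ℚ`-plane.** [folklore] -/
theorem trdeg_SF_le_of_span_le {x x' : Fin 2 → ℂ}
    (h : Submodule.span ℚ (Set.range x') ≤ Submodule.span ℚ (Set.range x)) :
    Algebra.trdeg ℚ (SF x') ≤ Algebra.trdeg ℚ (SF x) := by
  have hT : ∀ z ∈ Set.range x' ∪ Set.range (Complex.exp ∘ x'), IsAlgebraic (SF x) z := by
    rintro z (⟨i, rfl⟩ | ⟨i, rfl⟩)
    · have hm := (mem_SF_and_isAlgebraic_exp_of_mem_span x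
        (h (Submodule.subset_span ⟨i, rfl⟩))).1
      exact isAlgebraic_algebraMap (⟨x' i, hm⟩ : SF x)
    · exact (mem_SF_and_isAlgebraic_exp_of_mem_span x (h (Submodule.subset_span ⟨i, rfl⟩))).2
  have heq := trdeg_adjoin_union_eq_of_isAlgebraic_adjoin'
    (Set.range x ∪ Set.range (Complex.exp ∘ x)) (Set.range x' ∪ Set.range (Complex.exp ∘ x')) hT
  have hle : SF x' ≤ adjoin ℚ (Set.range x ∪ Set.range (Complex.exp ∘ x) ∪
      (Set.range x' ∪ Set.range (Complex.exp ∘ x'))) :=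
    adjoin.mono ℚ _ _ Set.subset_union_right
  exact (trdeg_mono hle).trans_eq heq

/-- **The crux is an invariant of the `ℚ`-plane `span_ℚ(x)`** (in particular `GL₂(ℚ)`-invariant).
[folklore] -/
theorem trdeg_SF_eq_of_span_eq {x x' : Fin 2 → ℂ}
    (h : Submodule.span ℚ (Set.range x) = Submodule.span ℚ (Set.range x')) :
    Algebra.trdeg ℚ (SF x) = Algebra.trdeg ℚ (SF x') :=
  le_antisymm (trdeg_SF_le_of_span_le h.le) (trdeg_SF_le_of_span_le h.ge)

/-- **Every `ℚ`-plane through `π` satisfies the crux** (`π ∈ ℚ(x, e^x)`, `e^π` algebraic over it,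
`{π, e^π}` algebraically independent — Nesterenko at `τ = i`): e.g. `x = (π + log 2, π − log 2)`,
`(3π/2 + e, e)`. No linear independence needed. [cite: NesterenkoPhilippon2001, Ch. 3 Corollary 1.2] -/
theorem schanuelTwo_of_pi_mem_span (x : Fin 2 → ℂ)
    (hpi : (Real.pi : ℂ) ∈ Submodule.span ℚ (Set.range x)) :
    (2 : Cardinal) ≤ Algebra.trdeg ℚ (SF x) := by
  obtain ⟨hmem, halg⟩ := mem_SF_and_isAlgebraic_exp_of_mem_span x hpi
  refine two_le_trdeg_SF_of_isAlgebraic_pair x algebraicIndependent_pi_exp_pi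
    (isAlgebraic_algebraMap (⟨(Real.pi : ℂ), hmem⟩ : SF x)) ?_
  rw [Complex.ofReal_exp]
  exact halg

/-- `π` and `e^{π√3}` are algebraically independent over `ℚ` (as complex numbers): Nesterenko at
`τ = ρ`, PROVED in the tree (`nesterenko'_holds`). [cite: NesterenkoPhilippon2001, Ch. 1 §3 Corollary 3.2] -/
theorem algebraicIndependent_pi_exp_pi_mul_sqrt_three :
    AlgebraicIndependent ℚ ![(Real.pi : ℂ), ((Real.exp (Real.pi * Real.sqrt 3) : ℝ) : ℂ)] := by
  have hN := Literature.NumberTheory.Transcendental.nesterenko'_holds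
  have h2 : AlgebraicIndependent ℚ ![Real.pi, Real.exp (Real.pi * Real.sqrt 3)] := by
    have h := hN.comp ![(0 : Fin 3), 1] (by decide)
    convert h using 1
    funext i; fin_cases i <;> rfl
  have e : (![(Real.pi : ℂ), ((Real.exp (Real.pi * Real.sqrt 3) : ℝ) : ℂ)] : Fin 2 → ℂ) =
      (Complex.ofRealAm.restrictScalars ℚ) ∘ ![Real.pi, Real.exp (Real.pi * Real.sqrt 3)] := by
    funext i; fin_cases i <;> simp
  rw [e]
  exact h2.map' Complex.ofReal_injective

/-- **Every `ℚ`-plane through `π√3` satisfies the crux** (`π` is a root of `3X² − (π√3)²` over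
`ℚ(x, e^x)`, `e^{π√3}` is algebraic over it, `{π, e^{π√3}}` algebraically independent —
Nesterenko at `τ = ρ`); e.g. `x = (iπ, π√3)`, a pair not on a plane through `π`.
[cite: NesterenkoPhilippon2001, Ch. 1 §3 Corollary 3.2] -/
theorem schanuelTwo_of_pi_mul_sqrt_three_mem_span (x : Fin 2 → ℂ)
    (h3 : ((Real.pi * Real.sqrt 3 : ℝ) : ℂ) ∈ Submodule.span ℚ (Set.range x)) :
    (2 : Cardinal) ≤ Algebra.trdeg ℚ (SF x) := by
  obtain ⟨hmem, halg⟩ := mem_SF_and_isAlgebraic_exp_of_mem_span x h3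
  refine two_le_trdeg_SF_of_isAlgebraic_pair x algebraicIndependent_pi_exp_pi_mul_sqrt_three ?_ ?_
  · -- `π` is a root of `3 X² − (π√3)²`
    refine ⟨Polynomial.C 3 * Polynomial.X ^ 2 - Polynomial.C (⟨_, hmem⟩ ^ 2), ?_, ?_⟩
    · intro h0
      have := congrArg (fun p => Polynomial.coeff p 2) h0
      simp at this
    · simp only [map_sub, map_mul, map_pow, Polynomial.aeval_X, Polynomial.aeval_C, map_ofNat]
      simp only [IntermediateField.algebraMap_apply]
      push_cast
      rw [mul_pow, ← Complex.ofReal_pow (Real.sqrt 3), Real.sq_sqrt (by norm_num : (0:ℝ) ≤ 3)]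
      push_cast
      ring
  · rw [Complex.ofReal_exp]
    exact_mod_cast halg

/-- In particular the pair `(iπ, π√3)` (algebraically dependent, transcendental coordinates, not on
a plane through `π`) satisfies the crux. [cite: NesterenkoPhilippon2001, Ch. 1 §3 Corollary 3.2] -/
theorem schanuelTwo_at_piI_pi_mul_sqrt_three :
    (2 : Cardinal) ≤ Algebra.trdeg ℚ (SF ![(Real.pi : ℂ) * I, ((Real.pi * Real.sqrt 3 : ℝ) : ℂ)]) :=
  schanuelTwo_of_pi_mul_sqrt_three_mem_span _ (Submodule.subset_span ⟨1, by simp⟩)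


/-! ### §10 Near-misses (documented, deliberately NOT sorried so that this file stays importable)

The following instances of the crux are exactly the open problems named in the item text; each
is stated above as a PROVED implication `SchanuelTwo → …` (§6), and none is provable from the
tree. What is known at each, and what was tried:

* `2 ≤ trdeg ℚ (SF ![1, π i])` (`e, π`): known `trdeg ≥ 1` (Hermite, Lindemann) and "`e + π` or
  `e π` transcendental" (`transcendental_exp_one_add_pi_or_mul_pi_holds`); Nesterenko's method
  gives `π, e^π`, never `e` (barrier `NesterenkoModularScope`). Tried: nothing applies — no grid.
* `2 ≤ trdeg ℚ (SF ![1, e])` (`e, e^e`): known `trdeg ≥ 1`; Brownawell–Waldschmidt (tree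
  `BrownawellWaldschmidt.brownawell_waldschmidt`) give only `e^e ∉ ℚ̄ ∨ e^{e²} ∉ ℚ̄`, because
  their `2 × 2` grid needs two exponentials algebraic over `ℚ`, while a counterexample only makes
  `e^e` algebraic over `ℚ(e)`.
* `2 ≤ trdeg ℚ (SF ![log 2, √2 log 2])` (`log 2, 2^{√2}`): Gel'fond–Schneider gives `2^{√2} ∉ ℚ̄`,
  i.e. `trdeg ≥ 1` in a second way; `trdeg = 2` open (Waldschmidt's "`log 2` and `2^{√2}`").
* `2 ≤ trdeg ℚ (SF ![π i, log 2])` (`π, log 2`): Baker gives `1, iπ, log 2` linearly independent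
  over `ℚ̄` (so `π / log 2 ∉ ℚ̄`), never algebraic independence (barrier
  `AlgebraicIndependenceOfLogarithms`).
* Generic open locus: `x` `ℚ`-linearly independent, `¬ AlgebraicIndependent ℚ x`, some `x i`
  transcendental, `span_ℚ(x) ∌ π, π√3` (more generally: no CM-Nesterenko pair inside the
  algebraic closure of `ℚ(x, e^x)`).

Refutation side: a disproof needs `trdeg = 1` EXACTLY at an explicit pair (§5), inside `ecl(∅)²`
(§8); numerically one can only EXCLUDE low-height relations (PSLQ job, see NOTES.md) — no finite
computation certifies an algebraic relation between real constants. Verdict of this cycle: the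
crux resists; it is Schanuel `n = 2` verbatim (faithfully typed, §0/§6), neither misstated nor
cheaply false.
-/

end Summit.Schanuel.Schanuel.Cruxes.SchanuelTwo.Disproof

end
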